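import Literature.Geometry.Kaehler.ComplexTorusAnalyticIteratedIntersectionMultiplicityOneOpen
import Literature.Geometry.Kaehler.ComplexTorusAnalyticPolarizedTranslatesBezout
import Literature.Geometry.Kaehler.ComplexTorusAnalyticIteratedIntersectionPositivity
import HarnessLib

/-!
# Non-vanishing of `[Y] ∧ [D₀] ∧ ⋯ ∧ [D_{k−1}]` in every expected dimension, and the static case `τ = 0`
# of the iterated-intersection theorems

Layer `Literature/Geometry/Kaehler`; lane `lit-hodgefound`, seat p07, programme «INTERSECTION NUMBERS ARE
POINT COUNTS», file 15. Let `X = E/Λ` be a compact complex torus, `Y ⊆ X` closed analytic of pure dimension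
`d = r + k`, `D₀, …, D_{k−1} ⊆ X` closed analytic hypersurfaces, `Z(τ) = Y ∩ ⋂_j (D_j − τ_j)` for `τ ∈ X^k`.

§1 completes the non-vanishing criterion of `ComplexTorusAnalyticIteratedTranslatesProper` §5 (stated there
only in expected dimension `0`, `dim Y = k`) to EVERY expected dimension `r`:

  `[Y] ∧ [D₀] ∧ ⋯ ∧ [D_{k−1}] ≠ 0  ↔  every Z(τ) is non-empty  ↔  some Z(τ) has the expected pure dimension r
                                   ↔  almost every Z(τ) has the expected pure dimension r`

("`[W] · [H]^r ≠ 0` iff every `r` translates of `H` meet `W`": file 10 gives `⟹` — a non-zero class has an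
`r`-dimensional representative inside EVERY `Z(τ)` —, file 8 §6 gives `Z(τ)` proper non-empty `⟹` class
`≠ 0`, and the generic `τ` (file 4 §5, dense) is proper). §2 records the STATIC case `τ = 0` of the main
theorems of files 8–13 — no translates in the statements — for consumers: the intersection class of a
proper `Y ∩ ⋂_j D_j` is `[Y ∩ ⋂_j D_j] + cl(T)`, `T ≥ 0` on it (Fulton Prop. 7.1 (a) / §12.2 (a)); for an
arbitrary configuration it is the class of an effective cycle on `Y ∩ ⋂_j D_j` (Thm. 12.2 (a)); Bézout on a
polarised torus; `#(Y ∩ ⋂_j D_j) ≤ N` in expected dimension `0`; and stability of multiplicity one under small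
translations. [Fulton1998, §7.1 Prop. 7.1 (a), §8.4 Example 8.4.6, §10.2 Example 10.2.1, §12.2 (a)]
[Lange2023AbelianVarietiesComplex, §4.6.2] [Chirka1989, §12.1, §16.1].

Contents (theorems only; no definitions, no named facts):

* §1 **`wedge_wedgeFamily_ne_zero_iff_forall_inter_iInter_translate_nonempty_of_le`**,
  `wedge_wedgeFamily_eq_zero_iff_exists_inter_iInter_translate_eq_empty_of_le`,
  **`wedge_wedgeFamily_ne_zero_iff_exists_hasPureDim_inter_iInter_translate`**,
  `wedge_wedgeFamily_ne_zero_iff_ae_hasPureDim_inter_iInter_translate`;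
* §2 (static, `τ = 0`) `exists_effectiveCycle_smul_wedge_wedgeFamily_eq_setCycleClass_inter_iInter_add`,
  `exists_effectiveCycle_smul_wedge_wedgeFamily_eq_chainCycleClass_inter_iInter`,
  `wedge_wedgeFamily_ne_zero_of_hasPureDim_inter_iInter`,
  `IsRiemannForm.ncard_isIrreducibleComponent_inter_iInter_le_re_poincarePairing`,
  `ncard_inter_iInter_le_re_torusIntegral`, `eventually_smul_wedge_wedgeFamily_eq_setCycleClass_of_inter_iInter`.

## References

* [Fulton1998] W. Fulton, *Intersection Theory*, 2nd ed., Springer 1998, §7.1 Prop. 7.1 (a), §8.2 (8.8),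
  §8.4 Prop. 8.4 and Example 8.4.6, §10.2 Example 10.2.1, Example 11.4.5, §12.2 Thm. 12.2 (a).
* [Lange2023AbelianVarietiesComplex] H. Lange, *Abelian Varieties over the Complex Numbers*, Springer 2023,
  §4.6.2 Lemma 4.6.4, Lemma 4.6.5 and p. 235.
* [Chirka1989] E. M. Chirka, *Complex Analytic Sets*, Kluwer 1989, §12.1 (p. 136–139), §16.1 Prop. 1.
* [Kleiman1974Transversality] S. L. Kleiman, *The transversality of a general translate*, Compositio Math.
  28 (1974), Thm. 2.
-/

noncomputable section

open scoped Manifold Topology Pointwise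
open MeasureTheory Set Function Filter Module
open Literature.LinearAlgebra.Alternating

namespace Literature.Geometry.Kaehler
namespace ComplexTorus

universe u

variable {ι : Type*} [Fintype ι] [DecidableEq ι] {E : Type u} [NormedAddCommGroup E] [InnerProductSpace ℂ E]
  [FiniteDimensional ℂ E] [MeasurableSpace E] [BorelSpace E] (Φ : (ι → ℝ) ≃L[ℝ] E) {n : ℕ} (e : Fin n ≃ ι)

omit [Fintype ι] [DecidableEq ι] [FiniteDimensional ℂ E] [MeasurableSpace E] [BorelSpace E] in
/-- The sub-intersection over all indices is the iterated intersection. [folklore] -/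
private theorem inter_biInter_translate_univ₁₅ {k : ℕ} (Y : Set (ComplexTorus Φ))
    (D : Fin k → Set (ComplexTorus Φ)) (τ : Fin k → ComplexTorus Φ) :
    Y ∩ ⋂ j ∈ (Finset.univ : Finset (Fin k)), (fun x ↦ x + τ j) ⁻¹' D j =
      Y ∩ ⋂ j, (fun x ↦ x + τ j) ⁻¹' D j := by
  simp only [Finset.mem_univ, iInter_true]

omit [Fintype ι] [DecidableEq ι] [FiniteDimensional ℂ E] [MeasurableSpace E] [BorelSpace E] in
/-- The member at `τ = 0` is the static intersection `Y ∩ ⋂_j D_j`. [folklore] -/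
private theorem inter_iInter_translate_zero₁₅ {k : ℕ} (Y : Set (ComplexTorus Φ))
    (D : Fin k → Set (ComplexTorus Φ)) :
    Y ∩ ⋂ j, (fun x ↦ x + (0 : Fin k → ComplexTorus Φ) j) ⁻¹' D j = Y ∩ ⋂ j, D j := by
  simp only [Pi.zero_apply, add_zero, preimage_id']

/-! ### §1 `[Y] ∧ [D₀] ∧ ⋯ ∧ [D_{k−1}] ≠ 0` iff all the iterated translates meet `Y` (every expected dimension) -/

/-- **`[Y] ∧ [D₀] ∧ ⋯ ∧ [D_{k−1}] ≠ 0` iff `Y ∩ ⋂_j (D_j − τ_j) ≠ ∅` for EVERY `τ ∈ X^k`** (`Y` of pure dimension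
`d ≥ k`, `D_j` hypersurfaces; any real basis `e`). `⟹`: a non-zero intersection class is the class of an
effective cycle supported on `Z(τ)` containing an `(d − k)`-dimensional analytic subset (file 10). `⟸`: a
generic `τ` is proper (file 4 §5, a dense set); being non-empty, `Z(τ)` has the expected pure dimension and
then the class is non-zero (file 8 §6). The expected-dimension-`0` case is
`wedge_wedgeFamily_ne_zero_iff_forall_inter_iInter_translate_nonempty`. [cite: Fulton1998, §12.2 Thm. 12.2 (a) and Example 11.4.5]
[cite: Lange2023AbelianVarietiesComplex, §4.6.2 Lemma 4.6.4 and Lemma 4.6.5] [cite: Chirka1989, §12.1, p. 136] -/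
theorem wedge_wedgeFamily_ne_zero_iff_forall_inter_iInter_translate_nonempty_of_le {q : ℕ}
    (hq : 2 * q + 2 * 1 = n) (k : ℕ) {d p : ℕ} (hk : 2 * d + 2 * p = n) (hkd : k ≤ d)
    {Y : Set (ComplexTorus Φ)} (hY : HasPureDim 𝓘(ℂ, E) Y d)
    {D : Fin k → Set (ComplexTorus Φ)} (hD : ∀ j, HasPureDim 𝓘(ℂ, E) (D j) q) :
    (analyticCycleClass Φ e hk hY).wedge (wedgeFamily k fun j ↦ analyticCycleClass Φ e hq (hD j)) ≠ 0 ↔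
      ∀ τ : Fin k → ComplexTorus Φ, (Y ∩ ⋂ j, (fun x ↦ x + τ j) ⁻¹' D j).Nonempty := by
  have hng : finrank ℂ E * 2 = n := finrank_complex_mul_two Φ e
  have hq1 : q + 1 = finrank ℂ E := by omega
  constructor
  · intro hne τ
    obtain ⟨W, hW, -, hWsub⟩ := exists_hasPureDim_subset_inter_iInter_translate_of_ne_zero Φ e hq k hk
      (r := d - k) (by omega) hY hD hne τ
    exact hW.nonempty.mono hWsub
  · intro hall
    obtain ⟨-, hdense, -⟩ := isOpen_dense_ae_forall_inter_biInter_translate_eq_empty_or_hasPureDim Φ hq1 hkd hY hD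
    obtain ⟨σ, hσG⟩ := hdense.nonempty
    have hσ := hσG Finset.univ
    rw [inter_biInter_translate_univ₁₅, Finset.card_univ, Fintype.card_fin] at hσ
    rcases hσ with h0 | hP
    · exact absurd h0 (hall σ).ne_empty
    · exact wedge_wedgeFamily_ne_zero_of_hasPureDim Φ e hq k hk (r := d - k) (by omega) hY hD σ hP

/-- **`[Y] ∧ [D₀] ∧ ⋯ ∧ [D_{k−1}] = 0` iff SOME iterated translate misses `Y`** (`k ≤ dim Y`).
[cite: Fulton1998, §12.2 (a) and Example 11.4.5] [cite: Lange2023AbelianVarietiesComplex, §4.6.2 Lemma 4.6.4] -/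
theorem wedge_wedgeFamily_eq_zero_iff_exists_inter_iInter_translate_eq_empty_of_le {q : ℕ}
    (hq : 2 * q + 2 * 1 = n) (k : ℕ) {d p : ℕ} (hk : 2 * d + 2 * p = n) (hkd : k ≤ d)
    {Y : Set (ComplexTorus Φ)} (hY : HasPureDim 𝓘(ℂ, E) Y d)
    {D : Fin k → Set (ComplexTorus Φ)} (hD : ∀ j, HasPureDim 𝓘(ℂ, E) (D j) q) :
    (analyticCycleClass Φ e hk hY).wedge (wedgeFamily k fun j ↦ analyticCycleClass Φ e hq (hD j)) = 0 ↔
      ∃ τ : Fin k → ComplexTorus Φ, Y ∩ ⋂ j, (fun x ↦ x + τ j) ⁻¹' D j = ∅ := by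
  have h := (wedge_wedgeFamily_ne_zero_iff_forall_inter_iInter_translate_nonempty_of_le Φ e hq k hk hkd hY hD).not
  push Not at h
  simpa only [not_nonempty_iff_eq_empty] using h

/-- **`[Y] ∧ [D₀] ∧ ⋯ ∧ [D_{k−1}] ≠ 0` iff SOME `Z(τ)` is proper and non-empty** (of the expected pure dimension
`r = dim Y − k`): a non-empty proper member has a non-zero class (file 8 §6); conversely a generic `τ` is
proper and, the class being non-zero, `Z(τ) ≠ ∅`. [cite: Fulton1998, §12.2 (a), §7.1 Prop. 7.1 (a)]
[cite: Lange2023AbelianVarietiesComplex, §4.6.2 Lemma 4.6.4 and Lemma 4.6.5] -/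
theorem wedge_wedgeFamily_ne_zero_iff_exists_hasPureDim_inter_iInter_translate {q : ℕ}
    (hq : 2 * q + 2 * 1 = n) (k : ℕ) {d p r : ℕ} (hk : 2 * d + 2 * p = n) (hr : r + k = d)
    {Y : Set (ComplexTorus Φ)} (hY : HasPureDim 𝓘(ℂ, E) Y d)
    {D : Fin k → Set (ComplexTorus Φ)} (hD : ∀ j, HasPureDim 𝓘(ℂ, E) (D j) q) :
    (analyticCycleClass Φ e hk hY).wedge (wedgeFamily k fun j ↦ analyticCycleClass Φ e hq (hD j)) ≠ 0 ↔
      ∃ τ : Fin k → ComplexTorus Φ, HasPureDim 𝓘(ℂ, E) (Y ∩ ⋂ j, (fun x ↦ x + τ j) ⁻¹' D j) r := by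
  have hng : finrank ℂ E * 2 = n := finrank_complex_mul_two Φ e
  have hq1 : q + 1 = finrank ℂ E := by omega
  refine ⟨fun hne ↦ ?_, fun ⟨τ, hτ⟩ ↦ wedge_wedgeFamily_ne_zero_of_hasPureDim Φ e hq k hk hr hY hD τ hτ⟩
  have hall := (wedge_wedgeFamily_ne_zero_iff_forall_inter_iInter_translate_nonempty_of_le Φ e hq k hk
    (by omega) hY hD).1 hne
  obtain ⟨-, hdense, -⟩ := isOpen_dense_ae_forall_inter_biInter_translate_eq_empty_or_hasPureDim Φ hq1
    (show k ≤ d by omega) hY hD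
  obtain ⟨σ, hσG⟩ := hdense.nonempty
  have hσ := hσG Finset.univ
  rw [inter_biInter_translate_univ₁₅, Finset.card_univ, Fintype.card_fin, show d - k = r by omega] at hσ
  exact ⟨σ, hσ.resolve_left (hall σ).ne_empty⟩

/-- **`[Y] ∧ [D₀] ∧ ⋯ ∧ [D_{k−1}] ≠ 0` iff ALMOST EVERY `Z(τ)` is proper and non-empty.** Almost every `τ` is
proper (file 4 §5); when the class is non-zero every `Z(τ)` is non-empty, hence of the expected pure
dimension. [cite: Lange2023AbelianVarietiesComplex, §4.6.2 Lemma 4.6.4 and Lemma 4.6.5] [cite: Fulton1998, Example 11.4.5 and §12.2 (a)]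
[cite: Kleiman1974Transversality, Thm. 2] -/
theorem wedge_wedgeFamily_ne_zero_iff_ae_hasPureDim_inter_iInter_translate {q : ℕ}
    (hq : 2 * q + 2 * 1 = n) (k : ℕ) {d p r : ℕ} (hk : 2 * d + 2 * p = n) (hr : r + k = d)
    {Y : Set (ComplexTorus Φ)} (hY : HasPureDim 𝓘(ℂ, E) Y d)
    {D : Fin k → Set (ComplexTorus Φ)} (hD : ∀ j, HasPureDim 𝓘(ℂ, E) (D j) q) :
    (analyticCycleClass Φ e hk hY).wedge (wedgeFamily k fun j ↦ analyticCycleClass Φ e hq (hD j)) ≠ 0 ↔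
      ∀ᵐ τ ∂(volume : Measure (Fin k → ComplexTorus Φ)),
        HasPureDim 𝓘(ℂ, E) (Y ∩ ⋂ j, (fun x ↦ x + τ j) ⁻¹' D j) r := by
  have hng : finrank ℂ E * 2 = n := finrank_complex_mul_two Φ e
  have hq1 : q + 1 = finrank ℂ E := by omega
  constructor
  · intro hne
    have hall := (wedge_wedgeFamily_ne_zero_iff_forall_inter_iInter_translate_nonempty_of_le Φ e hq k hk
      (by omega) hY hD).1 hne
    obtain ⟨-, -, hae⟩ := isOpen_dense_ae_forall_inter_biInter_translate_eq_empty_or_hasPureDim Φ hq1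
      (show k ≤ d by omega) hY hD
    filter_upwards [hae] with σ hσG
    have hσ := hσG Finset.univ
    rw [inter_biInter_translate_univ₁₅, Finset.card_univ, Fintype.card_fin, show d - k = r by omega] at hσ
    exact hσ.resolve_left (hall σ).ne_empty
  · intro hae
    obtain ⟨τ, hτ⟩ := hae.exists
    exact wedge_wedgeFamily_ne_zero_of_hasPureDim Φ e hq k hk hr hY hD τ hτ

/-! ### §2 The static case `τ = 0`: the intersection class of `Y ∩ ⋂_j D_j` -/

/-- **THE INTERSECTION CYCLE OF A PROPER INTERSECTION `Y ∩ D₀ ∩ ⋯ ∩ D_{k−1}`** (no translates). If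
`Y ∩ ⋂_j D_j` is empty or of the expected pure dimension `r = dim Y − k`, then

  `sign(e)^k · [Y]_e ∧ [D₀]_e ∧ ⋯ ∧ [D_{k−1}]_e = [Y ∩ ⋂_j D_j]_e + cl(T)`

with `T ≥ 0` an analytic `r`-cycle supported on `Y ∩ ⋂_j D_j`: every proper component has intersection
multiplicity `≥ 1` (file 8 at `τ = 0`). [cite: Fulton1998, §7.1 Prop. 7.1 (a), §8.2 and §12.2 (a)]
[cite: Lange2023AbelianVarietiesComplex, §4.6.2 p. 235] [cite: Chirka1989, §12.1 Prop. (p. 139) and §16.1 Prop. 1] -/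
theorem exists_effectiveCycle_smul_wedge_wedgeFamily_eq_setCycleClass_inter_iInter_add {q : ℕ}
    (hq : 2 * q + 2 * 1 = n) (k : ℕ) {d p p' r : ℕ} (hk : 2 * d + 2 * p = n) (hp' : p + k = p') (hr : r + k = d)
    {Y : Set (ComplexTorus Φ)} (hY : HasPureDim 𝓘(ℂ, E) Y d)
    {D : Fin k → Set (ComplexTorus Φ)} (hD : ∀ j, HasPureDim 𝓘(ℂ, E) (D j) q)
    (hZ : Y ∩ ⋂ j, D j = ∅ ∨ HasPureDim 𝓘(ℂ, E) (Y ∩ ⋂ j, D j) r) :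
    ∃ T : HolomorphicChain 𝓘(ℂ, E) (ComplexTorus Φ) r, (∀ W, 0 ≤ T.mult W) ∧ T.support ⊆ Y ∩ ⋂ j, D j ∧
      (orientationSign Φ e : ℂ) ^ k •
          ((analyticCycleClass Φ e hk hY).wedge
              (wedgeFamily k fun j ↦ analyticCycleClass Φ e hq (hD j))).domDomCongr
            (finCongr (by omega : 2 * p + 2 * k = 2 * p')) =
        setCycleClass Φ e (by omega : 2 * r + 2 * p' = n) (Y ∩ ⋂ j, D j) +
          chainCycleClass Φ e (by omega : 2 * r + 2 * p' = n) T := by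
  have h0 := inter_iInter_translate_zero₁₅ Φ Y D
  have hZ' : Y ∩ ⋂ j, (fun x ↦ x + (0 : Fin k → ComplexTorus Φ) j) ⁻¹' D j = ∅ ∨
      HasPureDim 𝓘(ℂ, E) (Y ∩ ⋂ j, (fun x ↦ x + (0 : Fin k → ComplexTorus Φ) j) ⁻¹' D j) r := by
    rw [h0]; exact hZ
  obtain ⟨T, hT0, hTs, hTcl⟩ :=
    exists_effectiveCycle_smul_wedge_wedgeFamily_eq_setCycleClass_add_of_proper Φ e hq k hk hp' hr hY hD 0 hZ'
  rw [h0] at hTs hTcl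
  exact ⟨T, hT0, hTs, hTcl⟩

/-- **FULTON THM. 12.2 (a), STATIC FORM: the intersection class of ANY configuration `Y, D₀, …, D_{k−1}` is the
class of an effective `(dim Y − k)`-cycle supported on `Y ∩ ⋂_j D_j`** (file 10 at `τ = 0`); in particular
`[Y] ∧ [D₀] ∧ ⋯ ∧ [D_{k−1}] = 0` when `Y ∩ ⋂_j D_j = ∅`, or when `dim (Y ∩ ⋂_j D_j) < dim Y − k` everywhere.
[cite: Fulton1998, §12.2 Thm. 12.2 (a) and Cor. 12.2 (a); §11.1 Cor. 11.1] [cite: Chirka1989, §16.1 Prop. 1] -/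
theorem exists_effectiveCycle_smul_wedge_wedgeFamily_eq_chainCycleClass_inter_iInter {q : ℕ}
    (hq : 2 * q + 2 * 1 = n) (k : ℕ) {d p p' r : ℕ} (hk : 2 * d + 2 * p = n) (hp' : p + k = p') (hr : r + k = d)
    {Y : Set (ComplexTorus Φ)} (hY : HasPureDim 𝓘(ℂ, E) Y d)
    {D : Fin k → Set (ComplexTorus Φ)} (hD : ∀ j, HasPureDim 𝓘(ℂ, E) (D j) q) :
    ∃ R : HolomorphicChain 𝓘(ℂ, E) (ComplexTorus Φ) r, (∀ W, 0 ≤ R.mult W) ∧ R.support ⊆ Y ∩ ⋂ j, D j ∧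
      (orientationSign Φ e : ℂ) ^ k •
          ((analyticCycleClass Φ e hk hY).wedge
              (wedgeFamily k fun j ↦ analyticCycleClass Φ e hq (hD j))).domDomCongr
            (finCongr (by omega : 2 * p + 2 * k = 2 * p')) =
        chainCycleClass Φ e (by omega : 2 * r + 2 * p' = n) R := by
  obtain ⟨R, hR0, hRs, hRcl⟩ :=
    exists_effectiveCycle_smul_wedge_wedgeFamily_eq_chainCycleClass_support_subset Φ e hq k hk hp' hr hY hD 0
  rw [inter_iInter_translate_zero₁₅] at hRs
  exact ⟨R, hR0, hRs, hRcl⟩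

/-- **A proper non-empty `Y ∩ ⋂_j D_j` forces `[Y] ∧ [D₀] ∧ ⋯ ∧ [D_{k−1}] ≠ 0`** (file 8 §6 at `τ = 0`).
[cite: Fulton1998, §7.1 Prop. 7.1 (a) and §12.2 (a)] [cite: Lange2023AbelianVarietiesComplex, §4.6.2 Lemma 4.6.5] -/
theorem wedge_wedgeFamily_ne_zero_of_hasPureDim_inter_iInter {q : ℕ} (hq : 2 * q + 2 * 1 = n)
    (k : ℕ) {d p r : ℕ} (hk : 2 * d + 2 * p = n) (hr : r + k = d)
    {Y : Set (ComplexTorus Φ)} (hY : HasPureDim 𝓘(ℂ, E) Y d)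
    {D : Fin k → Set (ComplexTorus Φ)} (hD : ∀ j, HasPureDim 𝓘(ℂ, E) (D j) q)
    (hZ : HasPureDim 𝓘(ℂ, E) (Y ∩ ⋂ j, D j) r) :
    (analyticCycleClass Φ e hk hY).wedge (wedgeFamily k fun j ↦ analyticCycleClass Φ e hq (hD j)) ≠ 0 := by
  refine wedge_wedgeFamily_ne_zero_of_hasPureDim Φ e hq k hk hr hY hD 0 ?_
  rw [inter_iInter_translate_zero₁₅]
  exact hZ

/-- **BÉZOUT FOR A PROPER `Y ∩ D₀ ∩ ⋯ ∩ D_{k−1}` ON A POLARISED TORUS**: with `η` a Riemann form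
(`c₁(L) = ofRealForm(−η)`), the number of irreducible components of a proper `Y ∩ ⋂_j D_j` is at most
`(L^r · Y · D₀ ⋯ D_{k−1}) = Re ⟨c₁(L)^{∧r}, sign(e)^k · [Y]_e ∧ [D₀]_e ∧ ⋯⟩` (file 9 at `τ = 0`).
[cite: Fulton1998, §8.4 Prop. 8.4 and Example 8.4.6; §12.2 Example 12.2.1 (a)] [cite: deJong1993AmpleLineBundles, Ch. VII §4 Thm. 4.3.1] -/
theorem IsRiemannForm.ncard_isIrreducibleComponent_inter_iInter_le_re_poincarePairing {q : ℕ}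
    (hq : 2 * q + 2 * 1 = n) (k : ℕ) {d p p' r : ℕ} (hk : 2 * d + 2 * p = n) (hp' : p + k = p') (hr : r + k = d)
    {Y : Set (ComplexTorus Φ)} (hY : HasPureDim 𝓘(ℂ, E) Y d)
    {D : Fin k → Set (ComplexTorus Φ)} (hD : ∀ j, HasPureDim 𝓘(ℂ, E) (D j) q)
    (hZ : Y ∩ ⋂ j, D j = ∅ ∨ HasPureDim 𝓘(ℂ, E) (Y ∩ ⋂ j, D j) r)
    {η : E [⋀^Fin 2]→L[ℝ] ℝ} (hη : IsRiemannForm Φ η) :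
    (({C : Set (ComplexTorus Φ) | IsIrreducibleComponent 𝓘(ℂ, E) (Y ∩ ⋂ j, D j) C}.ncard : ℕ) : ℝ) ≤
      (poincarePairing Φ e (by omega : 2 * r + 2 * p' = n) (wedgePow (ofRealForm (-η)) r)
        ((orientationSign Φ e : ℂ) ^ k •
          ((analyticCycleClass Φ e hk hY).wedge
              (wedgeFamily k fun j ↦ analyticCycleClass Φ e hq (hD j))).domDomCongr
            (finCongr (by omega : 2 * p + 2 * k = 2 * p')))).re := by
  have h0 := inter_iInter_translate_zero₁₅ Φ Y D
  have hZ' : Y ∩ ⋂ j, (fun x ↦ x + (0 : Fin k → ComplexTorus Φ) j) ⁻¹' D j = ∅ ∨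
      HasPureDim 𝓘(ℂ, E) (Y ∩ ⋂ j, (fun x ↦ x + (0 : Fin k → ComplexTorus Φ) j) ⁻¹' D j) r := by
    rw [h0]; exact hZ
  have h := hη.ncard_isIrreducibleComponent_le_re_poincarePairing_of_proper Φ e hq k hk hp' hr hY hD 0 hZ'
  rw [h0] at h
  exact h

/-! ### §3 The static case in expected dimension zero, and stability -/

section DimensionZero

variable {g : ℕ} (e' : Fin (2 * g) ≃ ι)

/-- **`#(Y ∩ D₀ ∩ ⋯ ∩ D_{k−1}) ≤ N`** for a finite proper intersection in expected dimension `0` (`dim Y = k`),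
`N = ∫_X sign(e)^{k+1} · [Y]_e ∧ [D₀]_e ∧ ⋯ ∈ ℕ` the intersection number (file 11 at `τ = 0`).
[cite: Fulton1998, §10.2 Example 10.2.1 (b) and §8.2 (8.8)] [cite: Lange2023AbelianVarietiesComplex, §4.6.2 p. 235] -/
theorem ncard_inter_iInter_le_re_torusIntegral {q : ℕ} (hq : 2 * q + 2 * 1 = 2 * g)
    (k : ℕ) {p : ℕ} (hk : 2 * k + 2 * p = 2 * g) {Y : Set (ComplexTorus Φ)} (hY : HasPureDim 𝓘(ℂ, E) Y k)
    {D : Fin k → Set (ComplexTorus Φ)} (hD : ∀ j, HasPureDim 𝓘(ℂ, E) (D j) q) (hfin : (Y ∩ ⋂ j, D j).Finite) :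
    (((Y ∩ ⋂ j, D j).ncard : ℕ) : ℝ) ≤
      (torusIntegral Φ e' ((orientationSign Φ e' : ℂ) ^ (k + 1) •
        ((analyticCycleClass Φ e' hk hY).wedge
            (wedgeFamily k fun j ↦ analyticCycleClass Φ e' hq (hD j))).domDomCongr
          (finCongr (by omega : 2 * p + 2 * k = 2 * g)))).re := by
  have h0 := inter_iInter_translate_zero₁₅ Φ Y D
  have hfin' : (Y ∩ ⋂ j, (fun x ↦ x + (0 : Fin k → ComplexTorus Φ) j) ⁻¹' D j).Finite := by rw [h0]; exact hfin
  have h := ncard_inter_iInter_translate_le_re_torusIntegral Φ e' hq k hk hY hD 0 hfin'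
  rw [h0] at h
  exact h

end DimensionZero

/-- **STABILITY OF MULTIPLICITY ONE AT `τ = 0`**: if `Y ∩ ⋂_j D_j` is proper and
`sign(e)^k · [Y]_e ∧ [D₀]_e ∧ ⋯ ∧ [D_{k−1}]_e = [Y ∩ ⋂_j D_j]_e` (all components of multiplicity one), then
for all sufficiently small translates `τ`, `Y ∩ ⋂_j (D_j − τ_j)` is proper with
`sign(e)^k · [Y]_e ∧ ⋯ = [Y ∩ ⋂_j (D_j − τ_j)]_e` (file 13 at `τ = 0`).
[cite: Fulton1998, §10.2 Example 10.2.1 and §11.1 Cor. 11.1] [cite: Kleiman1974Transversality, Thm. 2] -/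
theorem eventually_smul_wedge_wedgeFamily_eq_setCycleClass_of_inter_iInter {q : ℕ} (hq : 2 * q + 2 * 1 = n)
    (k : ℕ) {d p p' r : ℕ} (hk : 2 * d + 2 * p = n) (hp' : p + k = p') (hr : r + k = d)
    {Y : Set (ComplexTorus Φ)} (hY : HasPureDim 𝓘(ℂ, E) Y d)
    {D : Fin k → Set (ComplexTorus Φ)} (hD : ∀ j, HasPureDim 𝓘(ℂ, E) (D j) q)
    (hZ : Y ∩ ⋂ j, D j = ∅ ∨ HasPureDim 𝓘(ℂ, E) (Y ∩ ⋂ j, D j) r)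
    (hcl : (orientationSign Φ e : ℂ) ^ k •
        ((analyticCycleClass Φ e hk hY).wedge
            (wedgeFamily k fun j ↦ analyticCycleClass Φ e hq (hD j))).domDomCongr
          (finCongr (by omega : 2 * p + 2 * k = 2 * p')) =
      setCycleClass Φ e (by omega : 2 * r + 2 * p' = n) (Y ∩ ⋂ j, D j)) :
    ∀ᶠ τ in 𝓝 (0 : Fin k → ComplexTorus Φ),
      (Y ∩ ⋂ j, (fun x ↦ x + τ j) ⁻¹' D j = ∅ ∨ HasPureDim 𝓘(ℂ, E) (Y ∩ ⋂ j, (fun x ↦ x + τ j) ⁻¹' D j) r) ∧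
        (orientationSign Φ e : ℂ) ^ k •
            ((analyticCycleClass Φ e hk hY).wedge
                (wedgeFamily k fun j ↦ analyticCycleClass Φ e hq (hD j))).domDomCongr
              (finCongr (by omega : 2 * p + 2 * k = 2 * p')) =
          setCycleClass Φ e (by omega : 2 * r + 2 * p' = n) (Y ∩ ⋂ j, (fun x ↦ x + τ j) ⁻¹' D j) := by
  have h0 := inter_iInter_translate_zero₁₅ Φ Y D
  refine eventually_proper_and_smul_wedge_wedgeFamily_eq_setCycleClass Φ e hq k hk hp' hr hY hD 0 ?_ ?_
  · rw [h0]; exact hZ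
  · rw [h0]; exact hcl

end ComplexTorus

end Literature.Geometry.Kaehler

end
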